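import Literature.MathematicalPhysics.QuantumManyBody.CondensateOccupationStability
import Summits.AtomisticToContinuum.BoseEinsteinCondensation.Theses.BECRewardDescent

/-!
# Route `BECRewardDescent`, support item `RigidCondensation` (stmt-AtomisticToContinuum-12878)

Deterministic, fixed-`(v, ρ, N, τ)` lemma consumed by the route's deciding theorem `closes`:
on the torus of side `L = (N/ρ)^{1/3}`, if

* the periodic ground-state energy `E₀ = E₀^per(N, L)` is finite,
* the rigidity body of `PeriodicRigidity` holds at `(ρ, N)` (any two `δ`-near-minimisers of the
  periodic energy are `η`-close in `L²([0,L)^{3N})` modulo a unit complex factor), and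
* the rewarded infimum `R(s) = inf_Ψ (⟨Ψ,HΨ⟩ + s (N - n₀(Ψ)))` satisfies `R(s) ≤ E₀ + sτN` for all
  `s` in some interval `(0, s₁]`,

then for some `δ > 0` every `δ`-near-minimiser `Ψ` of the periodic energy has
`n₀(Ψ) ≥ (1 - 2τ) N`.

Proof (as filed by the planner, with the linear Lipschitz bound of the tree): for `N = 0` there is
nothing to prove. For `N ≥ 1` fix `η = (τ/4)²` and the rigidity slack `δ₁ = δ(η)`; pick
`0 < s ≤ s₁` so small that `δ' := (3/2) s τ N ≤ δ₁`. Since `R(s) ≤ E₀ + sτN < ⊤` there is an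
`sτN/2`-minimiser `Φ` of the rewarded functional, so `⟨Φ,HΦ⟩ + s(N - n₀(Φ)) ≤ E₀ + δ'`; as
`E₀ ≤ ⟨Φ,HΦ⟩` and `E₀ ≠ ⊤` this gives both `⟨Φ,HΦ⟩ ≤ E₀ + δ'` and `N - n₀(Φ) ≤ (3/2)τN`. For any
`δ'`-near-minimiser `Ψ`, rigidity gives a unit `c` with `∫|Φ - cΨ|² ≤ η`, and the `L²`-Lipschitz
bound `n₀(Φ) ≤ n₀(cΨ) + 2N√η` (`condensateOccupation_le_add_lintegral_rpow`, LSSY App. A) with the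
phase invariance `n₀(cΨ) = n₀(Ψ)` yields `n₀(Ψ) ≥ (1 - 3τ/2)N - (τ/2)N = (1 - 2τ)N`.

References: LSSY 2005, App. A (A.11), (A.13) (`n₀ = ‖a₀·‖²`, `‖a₀‖ ≤ √N`); Fournais 2020,
(1.3)–(1.5) (`n₀`, `n₊ = N - n₀`).
-/

noncomputable section

namespace Summit.AtomisticToContinuum.BoseEinsteinCondensation.Theorems

open MeasureTheory Filter
open scoped ENNReal NNReal
open Literature.MathematicalPhysics.QuantumManyBody.BoseGas

/-- **`RigidCondensation` holds** (settles stmt-AtomisticToContinuum-12878, exact route decl): at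
fixed `(v, ρ, N, τ)`, finiteness of `E₀^per`, rigidity of near-minimisers modulo a phase, and the
reward bound `R(s) ≤ E₀^per + sτN` on some `(0, s₁]` force `n₀ ≥ (1 - 2τ)N` on all `δ`-near-minimisers
for some `δ > 0` (near-minimiser of the rewarded functional + rigidity + `2N√η`-Lipschitz continuity
of `n₀`). [folklore] -/
theorem rigidCondensation_proof :
    Summit.AtomisticToContinuum.BoseEinsteinCondensation.Theses.BECRewardDescent.RigidCondensation := by
  unfold Summit.AtomisticToContinuum.BoseEinsteinCondensation.Theses.BECRewardDescent.RigidCondensation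
  intro v ρ N τ hτ
  dsimp only
  intro hE hRig hR
  cases N with
  | zero => exact ⟨1, zero_lt_one, fun Ψ _ => by simp⟩
  | succ n =>
  set L : ℝ := sideLength ρ (n + 1) with hLdef
  set E₀ : ℝ≥0∞ := periodicGroundStateEnergy v (n + 1) L with hE₀def
  obtain ⟨s₁, hs₁, hRs⟩ := hR
  -- rigidity at `η = (τ/4)²`, so that `2N√η = (τ/2) N`
  obtain ⟨δ₁, hδ₁, hrig⟩ := hRig ((τ / 4) ^ 2) (by positivity)
  -- a finite positive real below the rigidity slack
  obtain ⟨dr, hdr, hdrle⟩ : ∃ dr : ℝ, 0 < dr ∧ ENNReal.ofReal dr ≤ δ₁ := by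
    rcases eq_or_ne δ₁ ⊤ with h | h
    · exact ⟨1, one_pos, h ▸ le_top⟩
    · exact ⟨δ₁.toReal, ENNReal.toReal_pos hδ₁.ne' h, (ENNReal.ofReal_toReal h).le⟩
  -- the reward strength `s`
  obtain ⟨s, hs_pos, hs_le, hs_bd⟩ :
      ∃ s : ℝ, 0 < s ∧ s ≤ s₁ ∧ 3 / 2 * s * τ * ((n + 1 : ℕ) : ℝ) ≤ dr := by
    refine ⟨min s₁ (dr / (2 * τ * ((n + 1 : ℕ) : ℝ))), lt_min hs₁ (by positivity),
      min_le_left _ _, ?_⟩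
    have h1 : min s₁ (dr / (2 * τ * ((n + 1 : ℕ) : ℝ))) ≤ dr / (2 * τ * ((n + 1 : ℕ) : ℝ)) :=
      min_le_right _ _
    rw [le_div_iff₀ (by positivity)] at h1
    linarith
  have hδ'pos : 0 < ENNReal.ofReal (3 / 2 * s * τ * ((n + 1 : ℕ) : ℝ)) :=
    ENNReal.ofReal_pos.mpr (by positivity)
  have hδ'le : ENNReal.ofReal (3 / 2 * s * τ * ((n + 1 : ℕ) : ℝ)) ≤ δ₁ :=
    (ENNReal.ofReal_le_ofReal hs_bd).trans hdrle
  -- an `sτN/2`-minimiser `Φ` of the rewarded functional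
  have hlt := lt_of_le_of_lt (hRs s hs_pos hs_le)
    (ENNReal.lt_add_right (ENNReal.add_ne_top.mpr ⟨hE, ENNReal.ofReal_ne_top⟩)
      (ENNReal.ofReal_pos.mpr
        (show (0 : ℝ) < s * τ * ((n + 1 : ℕ) : ℝ) / 2 by positivity)).ne')
  obtain ⟨Φ, hΦ⟩ := iInf_lt_iff.mp hlt
  have hsum : E₀ + ENNReal.ofReal (s * τ * ((n + 1 : ℕ) : ℝ)) +
      ENNReal.ofReal (s * τ * ((n + 1 : ℕ) : ℝ) / 2) =
      E₀ + ENNReal.ofReal (3 / 2 * s * τ * ((n + 1 : ℕ) : ℝ)) := by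
    rw [add_assoc, ← ENNReal.ofReal_add (by positivity) (by positivity)]
    congr 2
    ring
  have hΦ' := hΦ.trans_eq hsum
  -- (a) `Φ` is a `δ'`-near-minimiser of the periodic energy
  have hΦE : periodicEnergy v Φ ≤ E₀ + ENNReal.ofReal (3 / 2 * s * τ * ((n + 1 : ℕ) : ℝ)) :=
    le_self_add.trans hΦ'.le
  -- (b) `Φ` is `(1 - 3τ/2)`-condensed
  have hΦocc : ENNReal.ofReal ((1 - 3 / 2 * τ) * ((n + 1 : ℕ) : ℝ)) ≤
      condensateOccupation (n + 1) L Φ.ψ := by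
    have h1 : E₀ + ENNReal.ofReal s *
        (((n + 1 : ℕ) : ℝ≥0∞) - condensateOccupation (n + 1) L Φ.ψ) ≤
        E₀ + ENNReal.ofReal (3 / 2 * s * τ * ((n + 1 : ℕ) : ℝ)) :=
      (add_le_add_left (periodicGroundStateEnergy_le v Φ) _).trans hΦ'.le
    have h2 := (ENNReal.add_le_add_iff_left hE).mp h1
    have h3 : ENNReal.ofReal (3 / 2 * s * τ * ((n + 1 : ℕ) : ℝ)) =
        ENNReal.ofReal s * ENNReal.ofReal (3 / 2 * τ * ((n + 1 : ℕ) : ℝ)) := by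
      rw [← ENNReal.ofReal_mul hs_pos.le]
      congr 1
      ring
    rw [h3] at h2
    have h4 := (ENNReal.mul_le_mul_iff_right ((ENNReal.ofReal_pos.mpr hs_pos).ne')
      ENNReal.ofReal_ne_top).mp h2
    have h5 : ((n + 1 : ℕ) : ℝ≥0∞) ≤ condensateOccupation (n + 1) L Φ.ψ +
        ENNReal.ofReal (3 / 2 * τ * ((n + 1 : ℕ) : ℝ)) :=
      (tsub_le_iff_right.mp h4).trans_eq (add_comm _ _)
    refine ofReal_sub_mul_le_of_le_add (by positivity) (n + 1) ?_
    rwa [one_mul, ENNReal.ofReal_natCast]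
  -- the torus has positive side (a trial state exists)
  have hL : 0 < L := by
    by_contra hle
    have h1 := Φ.norm_eq
    have hcell : cellN (n + 1) L = ∅ := Set.eq_empty_iff_forall_notMem.2 fun X hX => by
      have hx : X 0 0 ∈ Set.Ico 0 L := hX 0 0
      rw [Set.mem_Ico] at hx
      exact hle (hx.1.trans_lt hx.2)
    rw [hcell, Measure.restrict_empty, lintegral_zero_measure] at h1
    exact zero_ne_one h1
  -- conclusion with `δ := δ' = (3/2) s τ N`
  refine ⟨ENNReal.ofReal (3 / 2 * s * τ * ((n + 1 : ℕ) : ℝ)), hδ'pos, fun Ψ hΨ => ?_⟩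
  obtain ⟨c, hc, hdist⟩ := hrig Φ Ψ (hΦE.trans (add_le_add_right hδ'le _))
    (hΨ.trans (add_le_add_right hδ'le _))
  have hcΨ : Continuous fun X => c * Ψ.ψ X := continuous_const.mul Ψ.contDiff.continuous
  have hc1 : ((‖c‖₊ : ℝ≥0∞) ^ 2) = 1 := by
    rw [← enorm_eq_nnnorm, ← ofReal_norm, hc]
    simp
  have hcΨ1 : ∫⁻ X in cellN (n + 1) L, (‖c * Ψ.ψ X‖₊ : ℝ≥0∞) ^ 2 ≤ 1 := by
    simp only [coe_nnnorm_mul_sq, hc1, one_mul]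
    exact Ψ.norm_eq.le
  have hlip := condensateOccupation_le_add_lintegral_rpow hL Φ.contDiff.continuous hcΨ
    Φ.norm_eq.le hcΨ1
  rw [condensateOccupation_const_mul_of_norm_eq_one (n + 1) L hc Ψ.ψ] at hlip
  have hsqrt : (2 : ℝ≥0∞) * ((n + 1 : ℕ) : ℝ≥0∞) * (ENNReal.ofReal ((τ / 4) ^ 2)) ^ (1 / 2 : ℝ) =
      ENNReal.ofReal (τ / 2 * ((n + 1 : ℕ) : ℝ)) := by
    rw [ofReal_rpow_half_eq_sqrt (by positivity), Real.sqrt_sq (by positivity),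
      two_mul_natCast_mul_ofReal]
    congr 1
    ring
  have hfin : ENNReal.ofReal ((1 - 3 / 2 * τ) * ((n + 1 : ℕ) : ℝ)) ≤
      condensateOccupation (n + 1) L Ψ.ψ + ENNReal.ofReal (τ / 2 * ((n + 1 : ℕ) : ℝ)) := by
    calc ENNReal.ofReal ((1 - 3 / 2 * τ) * ((n + 1 : ℕ) : ℝ))
        ≤ condensateOccupation (n + 1) L Φ.ψ := hΦocc
      _ ≤ condensateOccupation (n + 1) L Ψ.ψ + 2 * ((n + 1 : ℕ) : ℝ≥0∞) *
            (∫⁻ X in cellN (n + 1) L, (‖Φ.ψ X - c * Ψ.ψ X‖₊ : ℝ≥0∞) ^ 2) ^ (1 / 2 : ℝ) := hlip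
      _ ≤ condensateOccupation (n + 1) L Ψ.ψ + 2 * ((n + 1 : ℕ) : ℝ≥0∞) *
            (ENNReal.ofReal ((τ / 4) ^ 2)) ^ (1 / 2 : ℝ) := by gcongr
      _ = condensateOccupation (n + 1) L Ψ.ψ + ENNReal.ofReal (τ / 2 * ((n + 1 : ℕ) : ℝ)) := by
            rw [hsqrt]
  have hres := ofReal_sub_mul_le_of_le_add (by positivity : (0 : ℝ) ≤ τ / 2) (n + 1) hfin
  rwa [show (1 - 3 / 2 * τ - τ / 2) = 1 - 2 * τ by ring] at hres

end Summit.AtomisticToContinuum.BoseEinsteinCondensation.Theorems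

end
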